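import Literature.NumberTheory.Automorphic.HilbertRepSchur                 -- ★ `ContRepresentation.IsTopIrreducible.exists_apply_eq_smul_of_commute` (Schur, unitary)
import Mathlib.Analysis.InnerProductSpace.l2Space                          -- `HilbertBasis`
import Mathlib.Analysis.InnerProductSpace.Adjoint                          -- `ContinuousLinearMap.adjoint`
import Mathlib.LinearAlgebra.Matrix.Trace
import HarnessLib

/-!
# The trace on an isotypic block: `Σ_k ⟪e_k, (A ∘ B) e_k⟫ = tr(β) · Θ_τ(A)`

Topic `NumberTheory/Automorphic`; namespaces `Literature.NumberTheory.Automorphic.IsotypicBlock` (§1–§2, pure Hilbert space) and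
`ContRepresentation` (§3–§4).  THEOREMS ONLY (no definition, no instance, no notation, no named fact, no `sorry`).  Cell `hodgecm-mathlib`,
programme P3 «U3-mult», ROAD «TF», brick **B-TF3 = H2 «isotypic block trace»** of the ⊗̂-free decomposition of the residual letter `ArchFinTraceSplit`
(F0P3-p01 (g11) CENSUS (α); F0P3a-p07 (g5) CENSUS-TF-arch §3 B-TF3).

THE SETTING ([DeitmarEchterhoff2014, §7.3, Thm. 7.3.2]; [Gelbart1975, Lemma 10.6, (10.12)–(10.14)]).  `V`, `E` complex Hilbert spaces; a FINITE family
`U : σ → (V →ₗᵢ[ℂ] E)` of isometries with pairwise ORTHOGONAL ranges — «`m = |σ|` orthogonal copies of `V` inside `E`», the block `⨆_i range U_i`; a Hilbert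
basis `f` of `V`, so that `(i, l) ↦ U_i f_l` is an orthonormal basis of the block.
* §1 (pure Hilbert space) if an operator `C` acts on the copies through a matrix `β` and an operator `T` of `V` — `C (U_j v) = Σ_i β_{ij} U_i (T v)` —
  then along the block basis `Σ_{(i,l)} ⟪U_i f_l, C (U_i f_l)⟫ = tr(β) · Σ_l ⟪f_l, T f_l⟫` (`hasSum_inner_apply_of_apply_eq_sum_smul`; fibrewise
  `hasSum_inner_apply_fibre`): the off-diagonal copies are orthogonal, the diagonal ones isometric.
* §2 (Schur) if `U_i` intertwine a topologically irreducible unitary `τ` on `V` with a unitary `π` on `E`, and `B ∈ 𝓑(E)` commutes with `π(G)` and maps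
  the block into itself, then `B (U_j v) = Σ_i β_{ij} U_i v` for the matrix `β_{ij}` of Schur scalars of `U_i^* B U_j ∈ End_G(τ) = ℂ`
  (`exists_matrix_apply_eq_sum_smul`, ★ `IsTopIrreducible.exists_apply_eq_smul_of_commute`).
* §3 (assembly) if moreover `A ∈ 𝓑(E)` acts on every copy through one `T ∈ 𝓑(V)` (`A (U_i v) = U_i (T v)`; for `A = π(a)`, `T = τ(a)` this is the
  intertwining of integrated operators), then `Σ_{(i,l)} ⟪U_i f_l, (A ∘ B)(U_i f_l)⟫ = tr(β) · Θ`, `Θ = Σ_l ⟪f_l, T f_l⟫`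
  (`exists_matrix_hasSum_inner_comp`) — the «`Θ_{π_∞}(a) · tr π_f(Λ)|_{multiplicity space}`» shape of the trace of `R(a ⊗ Λ)` on an isotypic
  `G_∞ × ℋ(G_f, K′)`-block ([Gelbart1975, (10.14)]; [BorelJacquet1979, §4.6]).
HONEST LABEL: generic; HC_CM is proved only modulo the printed citations until rung 0 closes, and this file moves no count.

## References
* A. Deitmar, S. Echterhoff, *Principles of Harmonic Analysis*, 2nd ed. (2014), Lemma 6.1.7 (Schur), §7.3 Thm. 7.3.2 [DeitmarEchterhoff2014].
* S. Gelbart, *Automorphic Forms on Adele Groups* (1975), Lemma 10.6, (10.12)–(10.14) [Gelbart1975].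
* A. Borel, H. Jacquet, *Automorphic forms and automorphic representations*, PSPM 33.1 (1979), §4.6 [BorelJacquet1979].
-/

set_option autoImplicit false

noncomputable section

open scoped InnerProductSpace
open Filter

namespace Literature.NumberTheory.Automorphic

namespace IsotypicBlock

/-! ## §0 Sums over a product with a finite first factor -/

/-- A family on `σ × ι` with `σ` finite sums to `Σ_i a_i` as soon as every fibre `l ↦ g (i, l)` sums to `a_i`. [folklore] -/
private theorem hasSum_prod_of_fintype {σ ι α : Type*} [Fintype σ] [DecidableEq σ] [AddCommMonoid α] [TopologicalSpace α]
    [ContinuousAdd α] {g : σ × ι → α} {a : σ → α} (h : ∀ i, HasSum (fun l => g (i, l)) (a i)) :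
    HasSum g (∑ i, a i) := by
  have h1 : ∀ i, HasSum (Set.indicator (Set.range (Prod.mk i)) g) (a i) := fun i => by
    rw [← (Prod.mk_right_injective i).hasSum_iff (f := Set.indicator (Set.range (Prod.mk i)) g)
      (fun p hp => Set.indicator_of_notMem hp _)]
    have : Set.indicator (Set.range (Prod.mk i)) g ∘ Prod.mk i = fun l => g (i, l) :=
      funext fun l => by rw [Function.comp_apply, Set.indicator_of_mem (Set.mem_range_self l)]
    rw [this]
    exact h i
  have h2 := hasSum_sum (s := Finset.univ) fun i _ => h1 i
  have hfun : (fun p : σ × ι => ∑ i, Set.indicator (Set.range (Prod.mk i)) g p) = g := by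
    funext p
    rw [Finset.sum_eq_single p.1]
    · exact Set.indicator_of_mem (show p ∈ Set.range (Prod.mk p.1) from ⟨p.2, rfl⟩) _
    · intro j _ hj
      exact Set.indicator_of_notMem (show p ∉ Set.range (Prod.mk j) from fun ⟨l, hl⟩ => hj (by rw [← hl])) _
    · intro hp
      exact absurd (Finset.mem_univ _) hp
  rwa [hfun] at h2

/-! ## §1 The block sum for an operator acting through a matrix: `Σ_{(i,l)} ⟪U_i f_l, C U_i f_l⟫ = tr(β) · Σ_l ⟪f_l, T f_l⟫` -/

variable {V E : Type*} [NormedAddCommGroup V] [InnerProductSpace ℂ V] [NormedAddCommGroup E] [InnerProductSpace ℂ E]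
  {ι σ : Type*} [Fintype σ] [DecidableEq σ]

omit [DecidableEq σ] in
/-- **Fibrewise**: on the `i`-th copy, `Σ_l ⟪U_i f_l, C (U_i f_l)⟫ = β_{ii} · Σ_l ⟪f_l, T f_l⟫` when `C (U_j v) = Σ_k β_{kj} U_k (T v)` (the copies `k ≠ i` are
orthogonal to `U_i f_l`, and `U_i` is isometric). [cite: Gelbart1975, Lemma 10.6 (10.14)] [cite: DeitmarEchterhoff2014, Thm. 7.3.2] -/
theorem hasSum_inner_apply_fibre (f : ι → V) (U : σ → (V →ₗᵢ[ℂ] E)) (hU : ∀ i j, i ≠ j → ∀ v w, ⟪U i v, U j w⟫_ℂ = 0)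
    (T : V →L[ℂ] V) {θ : ℂ} (hθ : HasSum (fun l => ⟪f l, T (f l)⟫_ℂ) θ)
    (C : E →L[ℂ] E) (β : Matrix σ σ ℂ) (hC : ∀ j v, C (U j v) = ∑ i, β i j • U i (T v)) (i : σ) :
    HasSum (fun l => ⟪U i (f l), C (U i (f l))⟫_ℂ) (β i i * θ) := by
  have h : ∀ l, ⟪U i (f l), C (U i (f l))⟫_ℂ = β i i * ⟪f l, T (f l)⟫_ℂ := fun l => by
    rw [hC, inner_sum, Finset.sum_eq_single i]
    · rw [inner_smul_right, LinearIsometry.inner_map_map]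
    · intro k _ hki
      rw [inner_smul_right, hU i k (Ne.symm hki), mul_zero]
    · intro hi
      exact absurd (Finset.mem_univ i) hi
  simp_rw [h]
  exact hθ.mul_left _

/-- **`Σ_{(i,l)} ⟪U_i f_l, C (U_i f_l)⟫ = tr(β) · Σ_l ⟪f_l, T f_l⟫`** along the orthonormal family `(i, l) ↦ U_i f_l` of the block, for an operator `C`
acting on the copies through the matrix `β` and the operator `T`: `C (U_j v) = Σ_i β_{ij} U_i (T v)`.  [cite: Gelbart1975, Lemma 10.6 (10.14)]
[cite: DeitmarEchterhoff2014, §7.3 Thm. 7.3.2] -/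
theorem hasSum_inner_apply_of_apply_eq_sum_smul (f : ι → V) (U : σ → (V →ₗᵢ[ℂ] E)) (hU : ∀ i j, i ≠ j → ∀ v w, ⟪U i v, U j w⟫_ℂ = 0)
    (T : V →L[ℂ] V) {θ : ℂ} (hθ : HasSum (fun l => ⟪f l, T (f l)⟫_ℂ) θ)
    (C : E →L[ℂ] E) (β : Matrix σ σ ℂ) (hC : ∀ j v, C (U j v) = ∑ i, β i j • U i (T v)) :
    HasSum (fun p : σ × ι => ⟪U p.1 (f p.2), C (U p.1 (f p.2))⟫_ℂ) (β.trace * θ) := by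
  rw [Matrix.trace, Finset.sum_mul]
  exact hasSum_prod_of_fintype fun i => hasSum_inner_apply_fibre f U hU T hθ C β hC i

omit [Fintype σ] [DecidableEq σ] in
/-- The family `(i, l) ↦ U_i f_l` is ORTHONORMAL when `f` is (orthogonal copies of an orthonormal family). [cite: DeitmarEchterhoff2014, §7.3 Thm. 7.3.2] -/
theorem orthonormal_block {f : ι → V} (hf : Orthonormal ℂ f) (U : σ → (V →ₗᵢ[ℂ] E)) (hU : ∀ i j, i ≠ j → ∀ v w, ⟪U i v, U j w⟫_ℂ = 0) :
    Orthonormal ℂ fun p : σ × ι => U p.1 (f p.2) := by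
  classical
  rw [orthonormal_iff_ite]
  rintro ⟨i, l⟩ ⟨j, l'⟩
  by_cases hij : i = j
  · subst hij
    rw [LinearIsometry.inner_map_map, orthonormal_iff_ite.1 hf]
    by_cases hll : l = l'
    · subst hll; simp
    · rw [if_neg hll, if_neg (fun h => hll (congrArg Prod.snd h))]
  · rw [hU i j hij, if_neg (fun h => hij (congrArg Prod.fst h))]


/-! ## §1b The block basis: `(i, l) ↦ U_i f_l` is a Hilbert basis of the closed block `closure (⨆_i range U_i)` -/

omit [Fintype σ] [DecidableEq σ] in
/-- **The block basis.**  For a Hilbert basis `f` of `V` and (any family of) isometries `U_i : V → E` with pairwise orthogonal ranges, the family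
`(i, l) ↦ U_i f_l` is a HILBERT BASIS of the closed block `closure (⨆_i range U_i)` (orthonormal by ★ `orthonormal_block`; complete: a vector of the
block orthogonal to every `U_i f_l` is orthogonal to every `range U_i` — `U_i^* x ⊥ f_l` for all `l` forces `U_i^* x = 0` — hence to the block, hence zero).
[cite: DeitmarEchterhoff2014, §7.3 Thm. 7.3.2] -/
theorem exists_hilbertBasis_block [CompleteSpace V] [CompleteSpace E] (f : HilbertBasis ι ℂ V) (U : σ → (V →ₗᵢ[ℂ] E))
    (hU : ∀ i j, i ≠ j → ∀ v w, ⟪U i v, U j w⟫_ℂ = 0) :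
    ∃ b : HilbertBasis (σ × ι) ℂ ↥(⨆ i, LinearMap.range (U i).toLinearMap).topologicalClosure,
      ∀ p, ((b p : ↥(⨆ i, LinearMap.range (U i).toLinearMap).topologicalClosure) : E) = U p.1 (f p.2) := by
  classical
  set K : Submodule ℂ E := (⨆ i, LinearMap.range (U i).toLinearMap).topologicalClosure with hK
  have hmem : ∀ p : σ × ι, U p.1 (f p.2) ∈ K := fun p =>
    Submodule.le_topologicalClosure _ (Submodule.mem_iSup_of_mem p.1 ⟨f p.2, rfl⟩)
  let e : σ × ι → ↥K := fun p => ⟨U p.1 (f p.2), hmem p⟩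
  have he : Orthonormal ℂ e := by
    rw [← K.subtypeₗᵢ.orthonormal_comp_iff]
    exact orthonormal_block f.orthonormal U hU
  -- completeness: the orthogonal complement of the span inside `K` is trivial
  have hbot : (Submodule.span ℂ (Set.range e))ᗮ = ⊥ := by
    rw [Submodule.eq_bot_iff]
    intro x hx
    -- `x ⊥ U_i f_l` for all `(i, l)`
    have hx0 : ∀ p : σ × ι, ⟪U p.1 (f p.2), (x : E)⟫_ℂ = 0 := fun p => by
      have h := Submodule.inner_right_of_mem_orthogonal (Submodule.subset_span (Set.mem_range_self p)) hx
      rwa [Submodule.coe_inner] at h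
    -- hence `U_i^* x = 0` for every `i`, i.e. `x ⊥ range U_i`
    have hadj : ∀ i, ContinuousLinearMap.adjoint (U i).toContinuousLinearMap (x : E) = 0 := fun i => by
      have hrepr : ∀ l, f.repr (ContinuousLinearMap.adjoint (U i).toContinuousLinearMap (x : E)) l = 0 := fun l => by
        rw [HilbertBasis.repr_apply_apply, ContinuousLinearMap.adjoint_inner_right]
        exact hx0 (i, l)
      have : f.repr (ContinuousLinearMap.adjoint (U i).toContinuousLinearMap (x : E)) = 0 := lp.ext (funext hrepr)
      exact (LinearIsometryEquiv.map_eq_zero_iff _).1 this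
    have horth : ∀ i (w : V), ⟪U i w, (x : E)⟫_ℂ = 0 := fun i w => by
      rw [← LinearIsometry.coe_toContinuousLinearMap, ← ContinuousLinearMap.adjoint_inner_right, hadj, inner_zero_right]
    -- so `x` is orthogonal to the block, which contains `x`
    have hle : (⨆ i, LinearMap.range (U i).toLinearMap) ≤ (ℂ ∙ (x : E))ᗮ := by
      refine iSup_le fun i => ?_
      rintro _ ⟨w, rfl⟩
      rw [Submodule.mem_orthogonal_singleton_iff_inner_right]
      change ⟪(x : E), U i w⟫_ℂ = 0
      rw [← inner_conj_symm, horth, map_zero]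
    have hxK : (x : E) ∈ (ℂ ∙ (x : E))ᗮ :=
      (Submodule.topologicalClosure_minimal _ hle (Submodule.isClosed_orthogonal _)) x.2
    rw [Submodule.mem_orthogonal_singleton_iff_inner_right] at hxK
    exact Subtype.ext (inner_self_eq_zero.1 hxK)
  exact ⟨HilbertBasis.mkOfOrthogonalEqBot he hbot, fun p => by rw [HilbertBasis.coe_mkOfOrthogonalEqBot]⟩

end IsotypicBlock

end Literature.NumberTheory.Automorphic

/-! ## §2 Schur: an operator commuting with `π(G)` acts on an isotypic block through a scalar matrix -/

namespace ContRepresentation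

open Literature.NumberTheory.Automorphic

variable {G : Type*} [Group G] {V E : Type*}
  [NormedAddCommGroup V] [InnerProductSpace ℂ V] [CompleteSpace V] [NormedAddCommGroup E] [InnerProductSpace ℂ E] [CompleteSpace E]
  {τ : ContRepresentation ℂ G V} {π : ContRepresentation ℂ G E}
  {σ : Type*} [Fintype σ] [DecidableEq σ]

/-- The adjoint of an intertwining isometry intertwines back: `U^* ∘ π(g) = τ(g) ∘ U^*` (unitarity: `π(g)^* = π(g⁻¹)`, `τ(g)^* = τ(g⁻¹)`).
[cite: DeitmarEchterhoff2014, Lemma 6.1.7] -/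
theorem adjoint_comp_apply_of_intertwining (hτ : τ.IsUnitary) (hπ : π.IsUnitary) (U : V →ₗᵢ[ℂ] E)
    (hUτ : ∀ g v, U (τ g v) = π g (U v)) (g : G) (x : E) :
    ContinuousLinearMap.adjoint U.toContinuousLinearMap (π g x) = τ g (ContinuousLinearMap.adjoint U.toContinuousLinearMap x) := by
  refine ext_inner_left ℂ fun v => ?_
  rw [ContinuousLinearMap.adjoint_inner_right, ← ContinuousLinearMap.adjoint_inner_left (τ g : V →L[ℂ] V), hτ.adjoint_apply g,
    ContinuousLinearMap.adjoint_inner_right]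
  change ⟪U v, π g x⟫_ℂ = ⟪U (τ g⁻¹ v), x⟫_ℂ
  rw [hUτ, ← hπ.adjoint_apply g, ContinuousLinearMap.adjoint_inner_left]

omit [Fintype σ] in
/-- `U_i^* (U_k w) = 0` for orthogonal copies `k ≠ i`, and `U_i^* (U_i w) = w` (the coordinate projections of an orthogonal sum of copies).
[cite: DeitmarEchterhoff2014, §7.3 Thm. 7.3.2] -/
theorem adjoint_apply_copy (U : σ → (V →ₗᵢ[ℂ] E)) (hU : ∀ i j, i ≠ j → ∀ v w, ⟪U i v, U j w⟫_ℂ = 0) (i k : σ) (w : V) :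
    ContinuousLinearMap.adjoint (U i).toContinuousLinearMap (U k w) = if k = i then w else 0 := by
  refine ext_inner_left ℂ fun v => ?_
  rw [ContinuousLinearMap.adjoint_inner_right]
  change ⟪U i v, U k w⟫_ℂ = _
  by_cases hki : k = i
  · subst hki; rw [if_pos rfl, LinearIsometry.inner_map_map]
  · rw [if_neg hki, hU i k (Ne.symm hki), inner_zero_right]

/-- **Schur on an isotypic block.**  Let `τ` be a topologically irreducible unitary representation on `V`, `π` unitary on `E`, `U_i : V → E` (`i ∈ σ`
finite) intertwining isometries with pairwise orthogonal ranges, and `B ∈ 𝓑(E)` commuting with every `π(g)` and mapping the block `⨆_i range U_i` into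
itself.  Then there is a matrix `β` with `B (U_j v) = Σ_i β_{ij} U_i v` — `β_{ij}` is the Schur scalar of `U_i^* B U_j ∈ End_G(τ)`.
[cite: DeitmarEchterhoff2014, Lemma 6.1.7; §7.3 Thm. 7.3.2] [cite: Gelbart1975, Lemma 10.6] -/
theorem exists_matrix_apply_eq_sum_smul (hirr : τ.IsTopIrreducible) (hτ : τ.IsUnitary) (hπ : π.IsUnitary)
    (U : σ → (V →ₗᵢ[ℂ] E)) (hUτ : ∀ i g v, U i (τ g v) = π g (U i v)) (hU : ∀ i j, i ≠ j → ∀ v w, ⟪U i v, U j w⟫_ℂ = 0)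
    (B : E →L[ℂ] E) (hB : ∀ g : G, Commute (π g : E →L[ℂ] E) B)
    (hBU : ∀ j v, B (U j v) ∈ ⨆ i, LinearMap.range (U i).toLinearMap) :
    ∃ β : Matrix σ σ ℂ, ∀ j v, B (U j v) = ∑ i, β i j • U i v := by
  classical
  -- the Schur scalars of `S_{ij} = U_i^* B U_j`
  have hS : ∀ i j, ∃ c : ℂ, ∀ v, ContinuousLinearMap.adjoint (U i).toContinuousLinearMap (B (U j v)) = c • v := by
    intro i j
    refine hirr.exists_apply_eq_smul_of_commute hτ (T := (ContinuousLinearMap.adjoint (U i).toContinuousLinearMap) ∘L B ∘L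
      (U j).toContinuousLinearMap) fun g => ?_
    ext v
    change τ g (ContinuousLinearMap.adjoint (U i).toContinuousLinearMap (B (U j v))) =
      ContinuousLinearMap.adjoint (U i).toContinuousLinearMap (B (U j (τ g v)))
    rw [hUτ, ← mul_apply_eq_comp B (π g), ← (hB g).eq, mul_apply_eq_comp,
      adjoint_comp_apply_of_intertwining hτ hπ (U i) (hUτ i)]
  choose β hβ using hS
  refine ⟨fun i j => β i j, fun j v => ?_⟩
  -- expand `B (U_j v)` in the block
  have hmem : B (U j v) ∈ ⨆ i ∈ (Finset.univ : Finset σ), LinearMap.range (U i).toLinearMap := by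
    simpa only [Finset.mem_univ, iSup_pos] using hBU j v
  obtain ⟨μ, hμ⟩ := (Submodule.mem_iSup_finset_iff_exists_sum (fun i => LinearMap.range (U i).toLinearMap) _).1 hmem
  have hw : ∀ i, ∃ w : V, (μ i : E) = U i w := fun i => by
    obtain ⟨w, hw⟩ := LinearMap.mem_range.1 (μ i).2
    exact ⟨w, hw.symm⟩
  choose w hw using hw
  have hsum : B (U j v) = ∑ i, U i (w i) := by
    rw [← hμ]; exact Finset.sum_congr rfl fun i _ => hw i
  -- apply `U_i^*`: `w i = β i j • v`
  have hwi : ∀ i, w i = β i j • v := fun i => by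
    have h := hβ i j v
    rw [hsum, map_sum, Finset.sum_eq_single i] at h
    · rwa [adjoint_apply_copy U hU i i, if_pos rfl] at h
    · intro k _ hki
      rw [adjoint_apply_copy U hU i k, if_neg hki]
    · intro hi
      exact absurd (Finset.mem_univ i) hi
  rw [hsum]
  exact Finset.sum_congr rfl fun i _ => by rw [hwi i, LinearIsometry.map_smul]

/-! ## §3 Assembly: `Σ_{(i,l)} ⟪U_i f_l, (A ∘ B)(U_i f_l)⟫ = tr(β) · Θ` -/

/-- **The trace of `A ∘ B` on an isotypic block is `tr(β) · Θ`.**  With the data of ★ `exists_matrix_apply_eq_sum_smul` and an operator `A ∈ 𝓑(E)` acting on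
every copy through one `T ∈ 𝓑(V)` (`A (U_i v) = U_i (T v)` — for `A = π(a)`, `T = τ(a)`), and a Hilbert basis `f` of `V` along which `Σ_l ⟪f_l, T f_l⟫ = Θ`:
there is a matrix `β` (that of `B` on the copies) with `Σ_{(i,l)} ⟪U_i f_l, (A ∘ B)(U_i f_l)⟫ = tr(β) · Θ` — the orthonormal family `(i,l) ↦ U_i f_l`
(★ `IsotypicBlock.orthonormal_block`) being a Hilbert basis of the block.  [cite: Gelbart1975, Lemma 10.6 (10.12)–(10.14)] [cite: BorelJacquet1979, §4.6]
[cite: DeitmarEchterhoff2014, §7.3 Thm. 7.3.2] -/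
theorem exists_matrix_hasSum_inner_comp (hirr : τ.IsTopIrreducible) (hτ : τ.IsUnitary) (hπ : π.IsUnitary)
    (U : σ → (V →ₗᵢ[ℂ] E)) (hUτ : ∀ i g v, U i (τ g v) = π g (U i v)) (hU : ∀ i j, i ≠ j → ∀ v w, ⟪U i v, U j w⟫_ℂ = 0)
    (B : E →L[ℂ] E) (hB : ∀ g : G, Commute (π g : E →L[ℂ] E) B)
    (hBU : ∀ j v, B (U j v) ∈ ⨆ i, LinearMap.range (U i).toLinearMap)
    (A : E →L[ℂ] E) (T : V →L[ℂ] V) (hA : ∀ i v, A (U i v) = U i (T v))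
    {ι : Type*} (f : HilbertBasis ι ℂ V) {θ : ℂ} (hθ : HasSum (fun l => ⟪f l, T (f l)⟫_ℂ) θ) :
    ∃ β : Matrix σ σ ℂ, (∀ j v, B (U j v) = ∑ i, β i j • U i v) ∧
      HasSum (fun p : σ × ι => ⟪U p.1 (f p.2), (A ∘L B) (U p.1 (f p.2))⟫_ℂ) (β.trace * θ) := by
  obtain ⟨β, hβ⟩ := exists_matrix_apply_eq_sum_smul hirr hτ hπ U hUτ hU B hB hBU
  refine ⟨β, hβ, IsotypicBlock.hasSum_inner_apply_of_apply_eq_sum_smul (fun l => f l) U hU T hθ (A ∘L B) β fun j v => ?_⟩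
  rw [ContinuousLinearMap.comp_apply, hβ, map_sum]
  exact Finset.sum_congr rfl fun i _ => by rw [map_smul, hA]

end ContRepresentation

end
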